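import Mathlib
import HarnessLib
import Summits.NavierStokesRegularity.NavierStokesRegularity.Theorems.PoloidalWindowDoorLrcModEntireThreadPins

/-!
# Route `PoloidalWindowDoor`, item `LrcModEntire` (stmt-NavierStokesRegularity-20428) / crux K2 (stmt-19708) —
# the THREADED HOT SPOT: the space-time second-order pin

LEAD of item 20428 ns-poloidal-K2-p3 g10 (`--supports stmt-NavierStokesRegularity-20428 --as helper`).
The hot spot `(−1,0)` of the thick column maximises the scale-invariant vertical size `√(−t)|v₂(t,x)|` over ALL of space-time
`(−∞,0) × ℝ³`, not only over the slice `t = −1`.  The second-order necessary condition along an arbitrary space-time line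
`s ↦ (−1 + sτ, s w)` therefore signs the full space-time Hessian of `v₂` at the hot spot, corrected by the weight:
`v₂(−1,0) · D²_{(t,x)} v₂ (−1,0)[(τ,w),(τ,w)] ≤ (3/4) τ² v₂(−1,0)²` (`threadSpaceTimeHessianPin`; `τ = 0` is the spatial pin
`threadHessianPin`, `w = 0` gives `v₂ ∂ₜ²v₂ ≤ (3/4) v₂²`).  Ingredients: joint real-analyticity of the class in `(t,x)` (tree
`analyticOnNhd_uncurry`), the first-order pins `threadTimePin` (`∂ₜv₂ = v₂/2`) and `threadPin_of_hotSpot` (`∇v₂ = 0`), and LOCAL versions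
(differentiability only near the point) of the one-variable second-derivative test and of the line/diagonal identification.
* `deriv2_nonpos_of_isLocalMax_local`, `deriv2_line_eq_iteratedFDeriv_local` — local calculus;
* `spaceTime_fderiv_time`, `spaceTime_fderiv_space` — the first space-time derivative of `v₂` at the hot spot is `(τ,w) ↦ τ v₂/2`;
* `threadSpaceTimeHessianPin` — the pin.
WHAT THIS IS NOT: not the thick stub, not a claim about Navier–Stokes regularity — calculus at a hot spot (bears_on LADDER-NS N0,
rung N0-LocalTubeDoorPoloidal). [folklore]
-/

noncomputable section

-- the summit and its single sub-problem share the name (CONVENTIONS §1), as in every Theorems file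
set_option linter.dupNamespace false

namespace Summit.NavierStokesRegularity.NavierStokesRegularity.Theorems.PoloidalWindowDoorLrcModEntireThreadSpaceTimePin

open MeasureTheory Set Function Filter Topology
open scoped RealInnerProductSpace InnerProductSpace
open Literature.Analysis Literature.Analysis.FluidPDE Literature.Analysis.UnboundedOperators
open Summit.NavierStokesRegularity.NavierStokesRegularity.Theorems.LocalSineTubeDoorProfileAlignedWindowRigidityAncient
open Summit.NavierStokesRegularity.NavierStokesRegularity.Theorems.PoloidalWindowDoorLrcModEntireThreadPins

/-! ### Local calculus -/

/-- LOCAL second-derivative test: `φ` differentiable near `0` with a local maximum at `0` has `φ″(0) ≤ 0` (if `φ″(0) > 0` the sign lemma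
makes `φ′ > 0` on `(0,ε)` and the mean value theorem contradicts the maximum). [folklore] -/
theorem deriv2_nonpos_of_isLocalMax_local {φ : ℝ → ℝ} (hφ : ∀ᶠ s in 𝓝 (0 : ℝ), DifferentiableAt ℝ φ s)
    (hmax : IsLocalMax φ 0) : deriv (deriv φ) 0 ≤ 0 := by
  by_contra hpos
  push Not at hpos
  have hd1 : deriv φ 0 = 0 := hmax.deriv_eq_zero
  have hsign := eventually_nhdsWithin_sign_eq_of_deriv_pos hpos hd1
  obtain ⟨ε, hε, hball⟩ := Metric.eventually_nhds_iff.1 (hsign.and (hmax.and hφ))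
  have hpos' : ∀ x : ℝ, 0 < x → x < ε → 0 < deriv φ x := by
    intro x hx0 hxε
    have hx : dist x 0 < ε := by rw [Real.dist_eq, sub_zero, abs_of_pos hx0]; exact hxε
    have h := (hball hx).1
    rw [sub_zero, sign_pos hx0, sign_eq_one_iff] at h
    exact h
  have hdiff : ∀ x : ℝ, 0 ≤ x → x < ε → DifferentiableAt ℝ φ x := by
    intro x hx0 hxε
    have hx : dist x 0 < ε := by rw [Real.dist_eq, sub_zero, abs_of_nonneg hx0]; exact hxε
    exact (hball hx).2.2
  obtain ⟨c, hc, hcd⟩ := exists_deriv_eq_slope φ (by linarith : (0 : ℝ) < ε / 2)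
    (fun x hx => (hdiff x hx.1 (by linarith [hx.2])).continuousAt.continuousWithinAt)
    (fun x hx => (hdiff x hx.1.le (by linarith [hx.2])).differentiableWithinAt)
  have h1 : 0 < deriv φ c := hpos' c hc.1 (by linarith [hc.2])
  have hε2 : dist (ε / 2) 0 < ε := by rw [Real.dist_eq, sub_zero, abs_of_pos (by linarith)]; linarith
  have h2 : φ (ε / 2) ≤ φ 0 := (hball hε2).2.1
  rw [hcd, sub_zero] at h1
  have h3 : 0 < φ (ε / 2) - φ 0 := (div_pos_iff_of_pos_right (by linarith)).1 h1
  linarith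

/-- LOCAL line/diagonal identification: if `f` is `C²` near `x` then `d²/dt² f(x + t w)|₀ = D²f(x)[w,w]`. [folklore] -/
theorem deriv2_line_eq_iteratedFDeriv_local {E : Type*} [NormedAddCommGroup E] [NormedSpace ℝ E] {f : E → ℝ} {x : E}
    (hf : ∀ᶠ y in 𝓝 x, ContDiffAt ℝ 2 f y) (w : E) :
    deriv (deriv (fun t : ℝ => f (x + t • w))) 0 = iteratedFDeriv ℝ 2 f x ![w, w] := by
  have hline : ∀ t : ℝ, HasDerivAt (fun t : ℝ => x + t • w) w t := fun t => by
    simpa using ((hasDerivAt_id t).smul_const w).const_add x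
  have hcont : Tendsto (fun t : ℝ => x + t • w) (𝓝 0) (𝓝 x) := by
    simpa using (hline 0).continuousAt.tendsto
  have hnear : ∀ᶠ t in 𝓝 (0 : ℝ), ContDiffAt ℝ 2 f (x + t • w) := hcont.eventually hf
  have h1 : deriv (fun t : ℝ => f (x + t • w)) =ᶠ[𝓝 0] fun t => fderiv ℝ f (x + t • w) w := by
    filter_upwards [hnear] with t ht
    exact ((ht.differentiableAt (by norm_num)).hasFDerivAt.comp_hasDerivAt t (hline t)).deriv
  rw [h1.deriv_eq]
  have hx2 : ContDiffAt ℝ 2 f x := hf.self_of_nhds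
  have hd2 : DifferentiableAt ℝ (fderiv ℝ f) x :=
    (hx2.fderiv_right (m := 1) (by norm_num)).differentiableAt (by norm_num)
  have hd2' : DifferentiableAt ℝ (fderiv ℝ f) (x + (0 : ℝ) • w) := by simpa using hd2
  have hc : HasDerivAt (fun t : ℝ => fderiv ℝ f (x + t • w)) (fderiv ℝ (fderiv ℝ f) (x + (0 : ℝ) • w) w) 0 :=
    hd2'.hasFDerivAt.comp_hasDerivAt (0 : ℝ) (hline 0)
  have h2 := hc.clm_apply (hasDerivAt_const (0 : ℝ) w)
  rw [h2.deriv, iteratedFDeriv_two_apply]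
  simp

/-! ### The space-time derivative of `v₂` at the hot spot -/

section Class

variable {v : ℝ → EuclideanSpace ℝ (Fin 3) → EuclideanSpace ℝ (Fin 3)} {C : ℝ}

/-- Joint analyticity of the class: `(t,x) ↦ v₂(t,x)` is `C²` near every point of the past. -/
theorem spaceTime_contDiffAt (hrate : HasTypeITimeDecay C v) (hcont : ContinuousOn (uncurry v) (Iio (0 : ℝ) ×ˢ univ))
    (hmild : ∀ s t : ℝ, s < t → t < 0 → ∀ x, v t x = heatExtension (v s) (t - s) x - oseenDuhamel 1 s v v t x)
    {P : ℝ × EuclideanSpace ℝ (Fin 3)} (hP : P.1 < 0) :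
    ∀ᶠ q in 𝓝 P, ContDiffAt ℝ 2 (fun p : ℝ × EuclideanSpace ℝ (Fin 3) => v p.1 p.2 2) q := by
  have han := analyticOnNhd_uncurry hcont (bdd_of_hasTypeITimeDecay hrate) hmild
  have hopen : IsOpen {q : ℝ × EuclideanSpace ℝ (Fin 3) | q.1 < 0} := isOpen_lt continuous_fst continuous_const
  filter_upwards [hopen.mem_nhds (show P ∈ {q : ℝ × EuclideanSpace ℝ (Fin 3) | q.1 < 0} from hP)] with q hq
  have hq' : q ∈ Iio (0 : ℝ) ×ˢ (univ : Set (EuclideanSpace ℝ (Fin 3))) := mem_prod.2 ⟨hq, mem_univ _⟩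
  have hA : AnalyticAt ℝ (fun p : ℝ × EuclideanSpace ℝ (Fin 3) => v p.1 p.2 2) q :=
    ((EuclideanSpace.proj (𝕜 := ℝ) (2 : Fin 3)).analyticAt _).comp (han q hq')
  exact hA.contDiffAt

/-- Time component of the space-time derivative at the hot spot: `D v₂(−1,0)(1,0) = ∂ₜv₂(−1,0) = v₂(−1,0)/2` (`threadTimePin`). -/
theorem spaceTime_fderiv_time (hrate : HasTypeITimeDecay C v) (hcont : ContinuousOn (uncurry v) (Iio (0 : ℝ) ×ˢ univ))
    (hmild : ∀ s t : ℝ, s < t → t < 0 → ∀ x, v t x = heatExtension (v s) (t - s) x - oseenDuhamel 1 s v v t x)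
    (hne : v (-1) 0 2 ≠ 0) (hhot : ∀ t < 0, ∀ x, Real.sqrt (-t) * |v t x 2| ≤ |v (-1) 0 2|) :
    fderiv ℝ (fun p : ℝ × EuclideanSpace ℝ (Fin 3) => v p.1 p.2 2) ((-1 : ℝ), (0 : EuclideanSpace ℝ (Fin 3)))
      ((1 : ℝ), (0 : EuclideanSpace ℝ (Fin 3))) = v (-1) 0 2 / 2 := by
  have hGd : DifferentiableAt ℝ (fun p : ℝ × EuclideanSpace ℝ (Fin 3) => v p.1 p.2 2)
      ((-1 : ℝ), (0 : EuclideanSpace ℝ (Fin 3))) :=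
    ((spaceTime_contDiffAt hrate hcont hmild (P := ((-1 : ℝ), (0 : EuclideanSpace ℝ (Fin 3)))) (by norm_num)).self_of_nhds
      ).differentiableAt (by norm_num)
  have hcurve : HasDerivAt (fun s : ℝ => ((s, (0 : EuclideanSpace ℝ (Fin 3))) : ℝ × EuclideanSpace ℝ (Fin 3)))
      ((1 : ℝ), (0 : EuclideanSpace ℝ (Fin 3))) (-1) :=
    (hasDerivAt_id (-1)).prodMk (hasDerivAt_const (-1 : ℝ) (0 : EuclideanSpace ℝ (Fin 3)))
  have hc := hGd.hasFDerivAt.comp_hasDerivAt (-1 : ℝ) hcurve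
  rw [← hc.deriv]
  exact threadTimePin hrate hcont hmild hne hhot

/-- Space components of the space-time derivative at the hot spot vanish: `D v₂(−1,0)(0,w) = ∇v₂(−1,0)·w = 0` (`threadPin_of_hotSpot`). -/
theorem spaceTime_fderiv_space (hrate : HasTypeITimeDecay C v) (hcont : ContinuousOn (uncurry v) (Iio (0 : ℝ) ×ˢ univ))
    (hmild : ∀ s t : ℝ, s < t → t < 0 → ∀ x, v t x = heatExtension (v s) (t - s) x - oseenDuhamel 1 s v v t x)
    (hhot : ∀ t < 0, ∀ x, Real.sqrt (-t) * |v t x 2| ≤ |v (-1) 0 2|) (w : EuclideanSpace ℝ (Fin 3)) :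
    fderiv ℝ (fun p : ℝ × EuclideanSpace ℝ (Fin 3) => v p.1 p.2 2) ((-1 : ℝ), (0 : EuclideanSpace ℝ (Fin 3)))
      ((0 : ℝ), w) = 0 := by
  have hGd : DifferentiableAt ℝ (fun p : ℝ × EuclideanSpace ℝ (Fin 3) => v p.1 p.2 2)
      ((-1 : ℝ), (0 : EuclideanSpace ℝ (Fin 3))) :=
    ((spaceTime_contDiffAt hrate hcont hmild (P := ((-1 : ℝ), (0 : EuclideanSpace ℝ (Fin 3)))) (by norm_num)).self_of_nhds
      ).differentiableAt (by norm_num)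
  have hemb : HasFDerivAt (fun y : EuclideanSpace ℝ (Fin 3) => (((-1 : ℝ), y) : ℝ × EuclideanSpace ℝ (Fin 3)))
      (ContinuousLinearMap.inr ℝ ℝ (EuclideanSpace ℝ (Fin 3))) 0 := hasFDerivAt_prodMk_right _ _
  have hcomp := (hGd.hasFDerivAt.comp (0 : EuclideanSpace ℝ (Fin 3)) hemb).fderiv
  have hsl := analyticOnNhd_slice hcont (bdd_of_hasTypeITimeDecay hrate) hmild (by norm_num : (-1 : ℝ) < 0)
  have hvd : DifferentiableAt ℝ (v (-1)) 0 := (hsl 0 (mem_univ _)).differentiableAt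
  have hfun : ((fun p : ℝ × EuclideanSpace ℝ (Fin 3) => v p.1 p.2 2) ∘
      fun y : EuclideanSpace ℝ (Fin 3) => (((-1 : ℝ), y) : ℝ × EuclideanSpace ℝ (Fin 3))) = fun z => v (-1) z 2 := rfl
  have h := congrArg (fun L : EuclideanSpace ℝ (Fin 3) →L[ℝ] ℝ => L w) hcomp
  simp only [ContinuousLinearMap.comp_apply, ContinuousLinearMap.inr_apply] at h
  rw [hfun, fderiv_apply_coord (v (-1)) hvd w 2, threadPin_of_hotSpot hrate hcont hmild hhot w] at h
  exact h.symm

/-- **SPACE-TIME HESSIAN PIN at the hot spot.**  For a profile of the class whose scale-invariant vertical size `√(−t)|v₂(t,x)|` peaks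
at `(−1,0)` with `v₂(−1,0) ≠ 0`, and every space-time direction `(τ,w)`:
`v₂(−1,0) · D²_{(t,x)}v₂(−1,0)[(τ,w),(τ,w)] ≤ (3/4) τ² v₂(−1,0)²`
(second-order test for `s ↦ σ √(1−sτ) v₂(−1+sτ, s w)` at `s = 0`, using `∂ₜv₂ = v₂/2`, `∇v₂ = 0` there). [folklore] -/
theorem threadSpaceTimeHessianPin (hrate : HasTypeITimeDecay C v) (hcont : ContinuousOn (uncurry v) (Iio (0 : ℝ) ×ˢ univ))
    (hmild : ∀ s t : ℝ, s < t → t < 0 → ∀ x, v t x = heatExtension (v s) (t - s) x - oseenDuhamel 1 s v v t x)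
    (hne : v (-1) 0 2 ≠ 0) (hhot : ∀ t < 0, ∀ x, Real.sqrt (-t) * |v t x 2| ≤ |v (-1) 0 2|) (τ : ℝ)
    (w : EuclideanSpace ℝ (Fin 3)) :
    v (-1) 0 2 * iteratedFDeriv ℝ 2 (fun p : ℝ × EuclideanSpace ℝ (Fin 3) => v p.1 p.2 2)
        ((-1 : ℝ), (0 : EuclideanSpace ℝ (Fin 3))) ![(τ, w), (τ, w)] ≤ 3 / 4 * τ ^ 2 * (v (-1) 0 2) ^ 2 := by
  -- first-order data (before introducing abbreviations)
  have hDt := spaceTime_fderiv_time hrate hcont hmild hne hhot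
  have hDx := spaceTime_fderiv_space hrate hcont hmild hhot w
  have hnear := spaceTime_contDiffAt hrate hcont hmild (P := ((-1 : ℝ), (0 : EuclideanSpace ℝ (Fin 3)))) (by norm_num)
  set G : ℝ × EuclideanSpace ℝ (Fin 3) → ℝ := fun p => v p.1 p.2 2 with hG
  set P : ℝ × EuclideanSpace ℝ (Fin 3) := ((-1 : ℝ), (0 : EuclideanSpace ℝ (Fin 3))) with hP
  set W : ℝ × EuclideanSpace ℝ (Fin 3) := (τ, w) with hW
  have hGP : ContDiffAt ℝ 2 G P := hnear.self_of_nhds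
  have hDW : fderiv ℝ G P W = τ * (v (-1) 0 2 / 2) := by
    have hWdec : W = τ • ((1 : ℝ), (0 : EuclideanSpace ℝ (Fin 3))) + ((0 : ℝ), w) := by simp [hW]
    rw [hWdec, map_add, map_smul, hDt, hDx, smul_eq_mul, add_zero]
  -- the sign `σ`
  obtain ⟨σ, hσabs, hσa⟩ : ∃ σ : ℝ, |σ| = 1 ∧ σ * v (-1) 0 2 = |v (-1) 0 2| := by
    rcases lt_or_gt_of_ne hne with h | h
    · exact ⟨-1, by simp, by rw [abs_of_neg h]; ring⟩
    · exact ⟨1, by simp, by rw [abs_of_pos h]; ring⟩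
  have hσle : ∀ y : ℝ, σ * y ≤ |y| := fun y =>
    calc σ * y ≤ |σ * y| := le_abs_self _
      _ = |y| := by rw [abs_mul, hσabs, one_mul]
  -- the weight `ρ(s) = √(1 − sτ)` and its first two derivatives at `0`
  set ρ : ℝ → ℝ := fun s => Real.sqrt (1 - s * τ) with hρ
  set ρ1 : ℝ → ℝ := fun s => 1 / (2 * Real.sqrt (1 - s * τ)) * (-τ) with hρ1
  have hρ_in : ∀ s : ℝ, HasDerivAt (fun s : ℝ => 1 - s * τ) (-τ) s := fun s => by
    simpa using ((hasDerivAt_id s).mul_const τ).const_sub 1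
  have hρd : ∀ s : ℝ, 1 - s * τ ≠ 0 → HasDerivAt ρ (ρ1 s) s := fun s hs =>
    (Real.hasDerivAt_sqrt hs).comp s (hρ_in s)
  have hρ0 : HasDerivAt ρ (ρ1 0) 0 := hρd 0 (by simp)
  have hρ1d : HasDerivAt ρ1 (-(τ ^ 2) / 4) 0 := by
    have h1 : HasDerivAt (fun s : ℝ => Real.sqrt (1 - s * τ)) (1 / (2 * Real.sqrt (1 - 0 * τ)) * (-τ)) 0 :=
      (Real.hasDerivAt_sqrt (by simp)).comp (0 : ℝ) (hρ_in 0)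
    have h2 := (h1.inv (by simp)).const_mul (-τ / 2)
    have hfun : ρ1 = fun s => (-τ / 2) * (Real.sqrt (1 - s * τ))⁻¹ := by
      funext s; simp only [hρ1]; ring
    rw [hfun]
    refine h2.congr_deriv ?_
    simp
    ring
  -- the space-time line `s ↦ P + sW` and `g = G` along it
  have hlineW : ∀ s : ℝ, HasDerivAt (fun s : ℝ => P + s • W) W s := fun s => by
    simpa using ((hasDerivAt_id s).smul_const W).const_add P
  have hPcont : Tendsto (fun s : ℝ => P + s • W) (𝓝 0) (𝓝 P) := by
    simpa using (hlineW 0).continuousAt.tendsto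
  have hgnear : ∀ᶠ s in 𝓝 (0 : ℝ), ContDiffAt ℝ 2 G (P + s • W) := hPcont.eventually hnear
  set g : ℝ → ℝ := fun s => G (P + s • W) with hg
  set g1 : ℝ → ℝ := fun s => fderiv ℝ G (P + s • W) W with hg1
  have hgd : ∀ᶠ s in 𝓝 (0 : ℝ), HasDerivAt g (g1 s) s := by
    filter_upwards [hgnear] with s hs
    exact (hs.differentiableAt (by norm_num)).hasFDerivAt.comp_hasDerivAt s (hlineW s)
  have hg0 : HasDerivAt g (g1 0) 0 := hgd.self_of_nhds
  have hg1d : HasDerivAt g1 (iteratedFDeriv ℝ 2 G P ![W, W]) 0 := by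
    have hd2 : DifferentiableAt ℝ (fderiv ℝ G) P :=
      (hGP.fderiv_right (m := 1) (by norm_num)).differentiableAt (by norm_num)
    have hd2' : DifferentiableAt ℝ (fderiv ℝ G) (P + (0 : ℝ) • W) := by simpa using hd2
    have hc := hd2'.hasFDerivAt.comp_hasDerivAt (0 : ℝ) (hlineW 0)
    have h2 := hc.clm_apply (hasDerivAt_const (0 : ℝ) W)
    refine h2.congr_deriv ?_
    rw [iteratedFDeriv_two_apply]
    simp
  -- the test function `φ(s) = σ ρ(s) g(s)`; differentiable near `0`, derivative formula near `0`
  set φ : ℝ → ℝ := fun s => σ * (ρ s * g s) with hφ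
  have hne1 : ∀ᶠ s in 𝓝 (0 : ℝ), 1 - s * τ ≠ 0 :=
    (hρ_in 0).continuousAt.eventually_ne (by simp)
  have hφd : ∀ᶠ s in 𝓝 (0 : ℝ), HasDerivAt φ (σ * (ρ1 s * g s + ρ s * g1 s)) s := by
    filter_upwards [hne1, hgd] with s hs1 hs2
    exact ((hρd s hs1).mul hs2).const_mul σ
  have hφdiff : ∀ᶠ s in 𝓝 (0 : ℝ), DifferentiableAt ℝ φ s := hφd.mono fun s hs => hs.differentiableAt
  have hderiv_eq : deriv φ =ᶠ[𝓝 0] fun s => σ * (ρ1 s * g s + ρ s * g1 s) := hφd.mono fun s hs => hs.deriv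
  have h2nd : HasDerivAt (fun s => σ * (ρ1 s * g s + ρ s * g1 s))
      (σ * ((-(τ ^ 2) / 4) * g 0 + ρ1 0 * g1 0 + (ρ1 0 * g1 0 + ρ 0 * iteratedFDeriv ℝ 2 G P ![W, W]))) 0 :=
    ((hρ1d.mul hg0).add (hρ0.mul hg1d)).const_mul σ
  have hdd : deriv (deriv φ) 0 =
      σ * ((-(τ ^ 2) / 4) * g 0 + ρ1 0 * g1 0 + (ρ1 0 * g1 0 + ρ 0 * iteratedFDeriv ℝ 2 G P ![W, W])) := by
    rw [hderiv_eq.deriv_eq]; exact h2nd.deriv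
  -- values at `0`
  have hg0v : g 0 = v (-1) 0 2 := by simp [hg, hG, hP]
  have hρ0v : ρ 0 = 1 := by simp [hρ]
  have hρ10v : ρ1 0 = -τ / 2 := by simp only [hρ1]; simp; ring
  have hg10v : g1 0 = τ * (v (-1) 0 2 / 2) := by simp only [hg1, zero_smul, add_zero]; exact hDW
  -- `φ` has a local maximum at `0`
  have hmax : IsLocalMax φ 0 := by
    have hnhds : ∀ᶠ s in 𝓝 (0 : ℝ), -1 + s * τ < 0 := by
      have hc : ContinuousAt (fun s : ℝ => -1 + s * τ) 0 := by fun_prop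
      exact hc.eventually_lt continuousAt_const (by simp)
    filter_upwards [hnhds] with s hs
    show σ * (ρ s * g s) ≤ σ * (ρ 0 * g 0)
    have hPs : P + s • W = ((-1 + s * τ : ℝ), s • w) := by
      simp [hP, hW]
    have hgs : g s = v (-1 + s * τ) (s • w) 2 := by simp only [hg, hG, hPs]
    have hρs : ρ s = Real.sqrt (-(-1 + s * τ)) := by simp only [hρ]; ring_nf
    rw [hgs, hρs, hg0v, hρ0v, one_mul]
    have hh := hhot (-1 + s * τ) hs (s • w)
    calc σ * (Real.sqrt (-(-1 + s * τ)) * v (-1 + s * τ) (s • w) 2)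
        = Real.sqrt (-(-1 + s * τ)) * (σ * v (-1 + s * τ) (s • w) 2) := by ring
      _ ≤ Real.sqrt (-(-1 + s * τ)) * |v (-1 + s * τ) (s • w) 2| :=
          mul_le_mul_of_nonneg_left (hσle _) (Real.sqrt_nonneg _)
      _ ≤ |v (-1) 0 2| := hh
      _ = σ * v (-1) 0 2 := hσa.symm
  -- the test
  have htest := deriv2_nonpos_of_isLocalMax_local hφdiff hmax
  rw [hdd, hg0v, hρ0v, hρ10v, hg10v] at htest
  have h1 : σ * iteratedFDeriv ℝ 2 G P ![W, W] ≤ 3 / 4 * τ ^ 2 * (σ * v (-1) 0 2) := by nlinarith [htest]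
  rw [hσa] at h1
  have h2 := mul_le_mul_of_nonneg_left h1 (abs_nonneg (v (-1) 0 2))
  have hσ2 : σ * σ = 1 := by
    have h := congrArg (fun r : ℝ => r ^ 2) hσabs
    simp only [sq_abs, one_pow] at h
    nlinarith [h]
  have haσ : |v (-1) 0 2| * σ = v (-1) 0 2 := by
    calc |v (-1) 0 2| * σ = (σ * v (-1) 0 2) * σ := by rw [hσa]
      _ = (σ * σ) * v (-1) 0 2 := by ring
      _ = v (-1) 0 2 := by rw [hσ2, one_mul]
  have e1 : |v (-1) 0 2| * (σ * iteratedFDeriv ℝ 2 G P ![W, W]) = v (-1) 0 2 * iteratedFDeriv ℝ 2 G P ![W, W] := by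
    rw [← mul_assoc, haσ]
  have e2 : |v (-1) 0 2| * (3 / 4 * τ ^ 2 * |v (-1) 0 2|) = 3 / 4 * τ ^ 2 * (v (-1) 0 2) ^ 2 := by
    rw [← sq_abs (v (-1) 0 2)]; ring
  rw [e1, e2] at h2
  exact h2

/-- The purely temporal entry: `v₂(−1,0) · ∂ₜ²v₂(−1,0) ≤ (3/4) v₂(−1,0)²` (`w = 0`, `τ = 1`). [folklore] -/
theorem threadTimeAccelerationPin (hrate : HasTypeITimeDecay C v) (hcont : ContinuousOn (uncurry v) (Iio (0 : ℝ) ×ˢ univ))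
    (hmild : ∀ s t : ℝ, s < t → t < 0 → ∀ x, v t x = heatExtension (v s) (t - s) x - oseenDuhamel 1 s v v t x)
    (hne : v (-1) 0 2 ≠ 0) (hhot : ∀ t < 0, ∀ x, Real.sqrt (-t) * |v t x 2| ≤ |v (-1) 0 2|) :
    v (-1) 0 2 * iteratedFDeriv ℝ 2 (fun p : ℝ × EuclideanSpace ℝ (Fin 3) => v p.1 p.2 2)
        ((-1 : ℝ), (0 : EuclideanSpace ℝ (Fin 3)))
        ![((1 : ℝ), (0 : EuclideanSpace ℝ (Fin 3))), ((1 : ℝ), (0 : EuclideanSpace ℝ (Fin 3)))] ≤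
      3 / 4 * (v (-1) 0 2) ^ 2 := by
  have h := threadSpaceTimeHessianPin hrate hcont hmild hne hhot 1 0
  simpa using h

/-! ### Appended (LEAD g10): kernel of the corrected space-time form — a flat spatial direction is flat in space-time -/
/-- **Kernel of a non-positive symmetric form** (abstract): `B` additive and homogeneous in the first slot, symmetric, `B u u ≤ 0` for all
`u` and `B e e = 0` ⇒ `B e w = 0` for all `w` (the quadratic `2ta + t²b ≤ 0 ∀ t` forces `a = 0`). [folklore] -/
theorem form_apply_eq_zero_of_nonpos_of_flat {F : Type*} [AddCommGroup F] [Module ℝ F] (B : F → F → ℝ)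
    (hadd : ∀ u u' w : F, B (u + u') w = B u w + B u' w) (hsmul : ∀ (c : ℝ) (u w : F), B (c • u) w = c * B u w)
    (hsymm : ∀ u w : F, B u w = B w u) (hsd : ∀ u : F, B u u ≤ 0) {e : F} (hflat : B e e = 0) (w : F) :
    B e w = 0 := by
  set a : ℝ := B e w with ha
  set b : ℝ := B w w with hb
  have hb0 : b ≤ 0 := hsd w
  have key : ∀ t : ℝ, 2 * t * a + t ^ 2 * b ≤ 0 := by
    intro t
    have h := hsd (e + t • w)
    have hexp : B (e + t • w) (e + t • w) = B e e + t * B e w + t * B e w + t ^ 2 * B w w := by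
      rw [hadd, hsmul, hsymm e (e + t • w), hsymm w (e + t • w), hadd, hsmul, hadd, hsmul, hsymm w e]; ring
    rw [hexp, hflat] at h
    have : 0 + t * B e w + t * B e w + t ^ 2 * B w w = 2 * t * a + t ^ 2 * b := by rw [ha, hb]; ring
    linarith [h, this]
  have h1b : 0 < 1 - b := by linarith
  have ht := key (a / (1 - b))
  have hid : 2 * (a / (1 - b)) * a + (a / (1 - b)) ^ 2 * b = a ^ 2 * ((2 - b) / (1 - b) ^ 2) := by
    field_simp; ring
  rw [hid] at ht
  have hpos : 0 < (2 - b) / (1 - b) ^ 2 := div_pos (by linarith) (by positivity)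
  have ha2 : a ^ 2 ≤ 0 := by
    by_contra hh
    exact absurd ht (not_le.2 (mul_pos (lt_of_not_ge hh) hpos))
  exact pow_eq_zero_iff (two_ne_zero) |>.mp (le_antisymm ha2 (sq_nonneg a))
/-- The corrected space-time form is non-positive: `σ · D²v₂(−1,0)[U,U] − (3/4)|v₂(−1,0)| τ_U² ≤ 0` with `σ = sign v₂(−1,0)` — the pin
`threadSpaceTimeHessianPin` divided by `|v₂(−1,0)|`. -/
theorem spaceTime_correctedForm_nonpos (hrate : HasTypeITimeDecay C v) (hcont : ContinuousOn (uncurry v) (Iio (0 : ℝ) ×ˢ univ))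
    (hmild : ∀ s t : ℝ, s < t → t < 0 → ∀ x, v t x = heatExtension (v s) (t - s) x - oseenDuhamel 1 s v v t x)
    (hne : v (-1) 0 2 ≠ 0) (hhot : ∀ t < 0, ∀ x, Real.sqrt (-t) * |v t x 2| ≤ |v (-1) 0 2|) {σ : ℝ}
    (hσa : σ * v (-1) 0 2 = |v (-1) 0 2|) (U : ℝ × EuclideanSpace ℝ (Fin 3)) :
    σ * iteratedFDeriv ℝ 2 (fun p : ℝ × EuclideanSpace ℝ (Fin 3) => v p.1 p.2 2)
        ((-1 : ℝ), (0 : EuclideanSpace ℝ (Fin 3))) ![U, U] - 3 / 4 * |v (-1) 0 2| * U.1 ^ 2 ≤ 0 := by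
  have h := threadSpaceTimeHessianPin hrate hcont hmild hne hhot U.1 U.2
  simp only [Prod.mk.eta] at h
  have hVpos : 0 < |v (-1) 0 2| := abs_pos.2 hne
  have hσ2 : σ * σ = 1 := by
    have h1 : (σ * v (-1) 0 2) ^ 2 = (v (-1) 0 2) ^ 2 := by rw [hσa, sq_abs]
    have hV2 : 0 < (v (-1) 0 2) ^ 2 := by positivity
    nlinarith [h1]
  have haσ : v (-1) 0 2 = |v (-1) 0 2| * σ := by
    calc v (-1) 0 2 = (σ * σ) * v (-1) 0 2 := by rw [hσ2, one_mul]
      _ = (σ * v (-1) 0 2) * σ := by ring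
      _ = |v (-1) 0 2| * σ := by rw [hσa]
  set D := iteratedFDeriv ℝ 2 (fun p : ℝ × EuclideanSpace ℝ (Fin 3) => v p.1 p.2 2)
    ((-1 : ℝ), (0 : EuclideanSpace ℝ (Fin 3))) ![U, U] with hD
  have h' : |v (-1) 0 2| * (σ * D) ≤ |v (-1) 0 2| * (3 / 4 * |v (-1) 0 2| * U.1 ^ 2) := by
    have e2 : |v (-1) 0 2| * (3 / 4 * |v (-1) 0 2| * U.1 ^ 2) = 3 / 4 * U.1 ^ 2 * (v (-1) 0 2) ^ 2 := by
      rw [← sq_abs (v (-1) 0 2)]; ring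
    rw [← mul_assoc, ← haσ, e2]; exact h
  have h'' := le_of_mul_le_mul_left h' hVpos
  linarith

/-- **SPACE-TIME FLAT KERNEL.**  If a spatial direction `e` is flat for the slice Hessian at the hot spot (`D²v₂(−1,·)(0)[e,e] = 0`), then
`(0,e)` is in the kernel of the whole space-time Hessian of `v₂` at `(−1,0)`: `D²_{(t,x)}v₂(−1,0)[(0,e), U] = 0` for every space-time
direction `U` — in particular (`U = (1,0)`) the mixed derivative `∂ₜ∂ₑ v₂(−1,0) = 0`. [folklore] -/
theorem threadSpaceTimeFlatKernel (hrate : HasTypeITimeDecay C v) (hcont : ContinuousOn (uncurry v) (Iio (0 : ℝ) ×ˢ univ))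
    (hmild : ∀ s t : ℝ, s < t → t < 0 → ∀ x, v t x = heatExtension (v s) (t - s) x - oseenDuhamel 1 s v v t x)
    (hne : v (-1) 0 2 ≠ 0) (hhot : ∀ t < 0, ∀ x, Real.sqrt (-t) * |v t x 2| ≤ |v (-1) 0 2|) {e : EuclideanSpace ℝ (Fin 3)}
    (hflat : iteratedFDeriv ℝ 2 (fun y => v (-1) y 2) 0 ![e, e] = 0) (U : ℝ × EuclideanSpace ℝ (Fin 3)) :
    iteratedFDeriv ℝ 2 (fun p : ℝ × EuclideanSpace ℝ (Fin 3) => v p.1 p.2 2)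
        ((-1 : ℝ), (0 : EuclideanSpace ℝ (Fin 3))) ![((0 : ℝ), e), U] = 0 := by
  have hnear := spaceTime_contDiffAt hrate hcont hmild (P := ((-1 : ℝ), (0 : EuclideanSpace ℝ (Fin 3)))) (by norm_num)
  obtain ⟨σ, hσabs, hσa⟩ : ∃ σ : ℝ, |σ| = 1 ∧ σ * v (-1) 0 2 = |v (-1) 0 2| := by
    rcases lt_or_gt_of_ne hne with h | h
    · exact ⟨-1, by simp, by rw [abs_of_neg h]; ring⟩
    · exact ⟨1, by simp, by rw [abs_of_pos h]; ring⟩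
  have hσne : σ ≠ 0 := fun h => by rw [h, abs_zero] at hσabs; exact zero_ne_one hσabs
  have hQ := spaceTime_correctedForm_nonpos hrate hcont hmild hne hhot hσa
  set G : ℝ × EuclideanSpace ℝ (Fin 3) → ℝ := fun p => v p.1 p.2 2 with hG
  set P : ℝ × EuclideanSpace ℝ (Fin 3) := ((-1 : ℝ), (0 : EuclideanSpace ℝ (Fin 3))) with hP
  have hGP : ContDiffAt ℝ 2 G P := hnear.self_of_nhds
  have hsymmG : IsSymmSndFDerivAt ℝ G P := hGP.isSymmSndFDerivAt (by simp)
  have hq : ∀ u u' : ℝ × EuclideanSpace ℝ (Fin 3), iteratedFDeriv ℝ 2 G P ![u, u'] = fderiv ℝ (fderiv ℝ G) P u u' := by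
    intro u u'; rw [iteratedFDeriv_two_apply]; simp
  set B : (ℝ × EuclideanSpace ℝ (Fin 3)) → (ℝ × EuclideanSpace ℝ (Fin 3)) → ℝ :=
    fun u u' => σ * fderiv ℝ (fderiv ℝ G) P u u' - 3 / 4 * |v (-1) 0 2| * (u.1 * u'.1) with hB
  have hadd : ∀ u u' w : ℝ × EuclideanSpace ℝ (Fin 3), B (u + u') w = B u w + B u' w := fun u u' w => by
    simp only [hB, map_add, add_apply, Prod.fst_add]; ring
  have hsmul : ∀ (c : ℝ) (u w : ℝ × EuclideanSpace ℝ (Fin 3)), B (c • u) w = c * B u w := fun c u w => by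
    simp only [hB, map_smul, FunLike.coe_smul, Pi.smul_apply, smul_eq_mul, Prod.smul_fst]; ring
  have hsymm : ∀ u w : ℝ × EuclideanSpace ℝ (Fin 3), B u w = B w u := fun u w => by
    simp only [hB, hsymmG u w]; ring
  have hsd : ∀ u : ℝ × EuclideanSpace ℝ (Fin 3), B u u ≤ 0 := fun u => by
    have h := hQ u
    rw [hq] at h
    simp only [hB]; nlinarith [h]
  have hE : B ((0 : ℝ), e) ((0 : ℝ), e) = 0 := by
    have hline : deriv (deriv (fun s : ℝ => G (P + s • ((0 : ℝ), e)))) 0 = iteratedFDeriv ℝ 2 G P ![((0 : ℝ), e), ((0 : ℝ), e)] :=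
      deriv2_line_eq_iteratedFDeriv_local hnear ((0 : ℝ), e)
    have hfa : ContDiff ℝ 2 (fun y => v (-1) y 2) := by
      have hsl := analyticOnNhd_slice hcont (bdd_of_hasTypeITimeDecay hrate) hmild (by norm_num : (-1 : ℝ) < 0)
      have han : AnalyticOnNhd ℝ (fun y => v (-1) y 2) univ := fun y _ =>
        ((EuclideanSpace.proj (𝕜 := ℝ) (2 : Fin 3)).analyticAt _).comp (hsl y (mem_univ _))
      exact han.contDiff
    have hslice := deriv2_line_eq_iteratedFDeriv hfa 0 e
    have hfun : (fun s : ℝ => G (P + s • ((0 : ℝ), e))) = fun s : ℝ => v (-1) (0 + s • e) 2 := by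
      funext s; simp [hG, hP]
    rw [hfun, hslice, hflat] at hline
    simp only [hB, ← hq, ← hline]
    ring
  have hker := form_apply_eq_zero_of_nonpos_of_flat B hadd hsmul hsymm hsd hE U
  simp only [hB] at hker
  rw [hq]
  exact (mul_eq_zero.1 (by linarith [hker] : σ * fderiv ℝ (fderiv ℝ G) P ((0 : ℝ), e) U = 0)).resolve_left hσne
end Class

end Summit.NavierStokesRegularity.NavierStokesRegularity.Theorems.PoloidalWindowDoorLrcModEntireThreadSpaceTimePin
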